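import Mathlib
import HarnessLib

/-!
# The Romberg T-table (Davis–Rabinowitz 1984, Sect. 6.3)

Davis–Rabinowitz, *Methods of Numerical Integration* (2nd ed., 1984), Sect. 6.3 "Romberg Integration",
pp. 434–436: Romberg integration = Richardson extrapolation applied to the Euler–Maclaurin expansion (6.3.2)
of the trapezoidal sums `T_0^{(k)} = h Σ'' f(jh)`, `h = 2^{-k}` (6.3.1); the T-table (6.3.3)–(6.3.4)
`T_m^{(k)} = (4^m T_{m-1}^{(k+1)} - T_{m-1}^{(k)})/(4^m - 1)`
`        = T_{m-1}^{(k+1)} + (T_{m-1}^{(k+1)} - T_{m-1}^{(k)})/(4^m - 1)`.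

Recorded over Mathlib's compound trapezoidal rule `trapezoidal_integral` (first column, `N = 2^k` panels on
`[a, b]`): the table `rombergT` and both forms of (6.3.3); the second column as `(4 T_{2^{k+1}} - T_{2^k})/3`
(the book's remark that these "turn out to be exactly those obtained by use of Simpson's rule" is the tree's
`simpsonRule_eq_trapezoidal`, not re-proved here); the leading behaviour
`|I - T_0^{(k)}| ≤ |b - a|³ ζ/(12 · 4^k)` of (6.3.2) for `f ∈ C²` (Mathlib's `trapezoidal_error_le_of_c2`);
and the column half of property (1) — "the columns ... of the T-table converge to `I`" — in hypothesis form
(trapezoidal column convergent ⇒ every column convergent, the weights `4^m/(4^m - 1)`, `-1/(4^m - 1)` summing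
to one) and outright for `f ∈ C²[a, b]`.
The diagonal statements of (1)–(3) and the coefficient formulas (4) are not restated.

Provenance: engines group, shared numerical engines serving client cells; rigour lives in the verifiers; every
published number belongs to a client cell's ledger, not to the engines group.  Textbook facts only (no client
numbers).
-/

namespace Literature.Analysis.Quadrature

open Finset Filter Topology MeasureTheory intervalIntegral
open scoped Real Interval

noncomputable section

/-- The Romberg *T-table* of `f` on `[a, b]` (6.3.1), (6.3.3): the first column `T_0^{(k)}` is Mathlib's compound
trapezoidal rule with `2^k` panels (`h = (b - a) 2^{-k}`), and
`T_m^{(k)} = (4^m T_{m-1}^{(k+1)} - T_{m-1}^{(k)})/(4^m - 1)`. [cite: DavisRabinowitz1984, Sect. 6.3 (6.3.3)] -/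
def rombergT (f : ℝ → ℝ) (a b : ℝ) : ℕ → ℕ → ℝ
  | 0, k => trapezoidal_integral f (2 ^ k) a b
  | m + 1, k => (4 ^ (m + 1) * rombergT f a b m (k + 1) - rombergT f a b m k) / (4 ^ (m + 1) - 1)

/-- (6.3.1): the first column consists of the trapezoidal sums with `2^k` panels.
[cite: DavisRabinowitz1984, Sect. 6.3 (6.3.1)] -/
theorem rombergT_zero (f : ℝ → ℝ) (a b : ℝ) (k : ℕ) :
    rombergT f a b 0 k = trapezoidal_integral f (2 ^ k) a b := by
  simp [rombergT]

/-- (6.3.3), first form. [cite: DavisRabinowitz1984, Sect. 6.3 (6.3.3)] -/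
theorem rombergT_succ (f : ℝ → ℝ) (a b : ℝ) (m k : ℕ) :
    rombergT f a b (m + 1) k =
      (4 ^ (m + 1) * rombergT f a b m (k + 1) - rombergT f a b m k) / (4 ^ (m + 1) - 1) := by
  simp [rombergT]

/-- [folklore] `4^{m+1} - 1 ≠ 0`. -/
private theorem four_pow_succ_sub_one_ne_zero (m : ℕ) : (4 : ℝ) ^ (m + 1) - 1 ≠ 0 := by
  have : (4 : ℝ) ≤ 4 ^ (m + 1) := by
    calc (4 : ℝ) = 4 ^ 1 := by norm_num
      _ ≤ 4 ^ (m + 1) := pow_le_pow_right₀ (by norm_num) (by omega)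
  linarith

/-- (6.3.3), second form: `T_m^{(k)} = T_{m-1}^{(k+1)} + (T_{m-1}^{(k+1)} - T_{m-1}^{(k)})/(4^m - 1)`.
[cite: DavisRabinowitz1984, Sect. 6.3 (6.3.3)] -/
theorem rombergT_succ' (f : ℝ → ℝ) (a b : ℝ) (m k : ℕ) :
    rombergT f a b (m + 1) k =
      rombergT f a b m (k + 1) + (rombergT f a b m (k + 1) - rombergT f a b m k) / (4 ^ (m + 1) - 1) := by
  rw [rombergT_succ]
  have h4 := four_pow_succ_sub_one_ne_zero m
  field_simp
  ring

/-- The second column: `T_1^{(k)} = (4 T_{2^{k+1}} - T_{2^k})/3` — "the values `T_1^{(k)}` turn out to be exactly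
those obtained by use of Simpson's rule" (the compound Simpson rule with `2^k` panels; the identification
`S_n = (4 T_{2n} - T_n)/3` is the tree's `simpsonRule_eq_trapezoidal`).
[cite: DavisRabinowitz1984, Sect. 6.3 (6.3.3)] -/
theorem rombergT_one (f : ℝ → ℝ) (a b : ℝ) (k : ℕ) :
    rombergT f a b 1 k =
      (4 * trapezoidal_integral f (2 * 2 ^ k) a b - trapezoidal_integral f (2 ^ k) a b) / 3 := by
  rw [rombergT_succ, rombergT_zero, rombergT_zero, pow_succ 2 k, mul_comm (2 ^ k) 2]
  norm_num

/-- An entry of the T-table is an affine combination (weights summing to one) of two entries of the previous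
column; in particular every `T_m^{(k)}` reproduces constants the way the trapezoidal column does.
[cite: DavisRabinowitz1984, Sect. 6.3 (6.3.3)] -/
theorem rombergT_succ_weights (m : ℕ) :
    (4 : ℝ) ^ (m + 1) / (4 ^ (m + 1) - 1) + (-1) / (4 ^ (m + 1) - 1) = 1 := by
  have h4 := four_pow_succ_sub_one_ne_zero m
  field_simp
  ring

/-- (6.3.2), leading behaviour of the first column for `f ∈ C²[a, b]`:
`|I - T_0^{(k)}| ≤ |b - a|³ ζ/(12 · 4^k)` (`= O(h²)`, `h = 2^{-k}`; Mathlib's trapezoidal error bound with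
`N = 2^k`).
[cite: DavisRabinowitz1984, Sect. 6.3 (6.3.2)] -/
theorem abs_rombergT_zero_sub_integral_le {f : ℝ → ℝ} {a b : ℝ} (h_f_c2 : ContDiffOn ℝ 2 f [[a, b]])
    {ζ : ℝ} (fpp_bound : ∀ x, |iteratedDerivWithin 2 f [[a, b]] x| ≤ ζ) (k : ℕ) :
    |rombergT f a b 0 k - ∫ x in a..b, f x| ≤ |b - a| ^ 3 * ζ / (12 * 4 ^ k) := by
  have h := trapezoidal_error_le_of_c2 h_f_c2 fpp_bound (N := 2 ^ k) (by positivity)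
  rw [trapezoidal_error] at h
  rw [rombergT_zero]
  convert h using 2
  push_cast
  rw [← pow_mul, show (4 : ℝ) = 2 ^ 2 by norm_num, ← pow_mul, mul_comm 2 k]

/-- Property (1), column half, in hypothesis form: if the trapezoidal column converges to `I` (the book: `f`
bounded and Riemann integrable), then every column of the T-table converges to `I` (`k → ∞`).
[cite: DavisRabinowitz1984, Sect. 6.3 (6.3.4)] -/
theorem tendsto_rombergT_column {f : ℝ → ℝ} {a b I : ℝ}
    (h0 : Tendsto (fun k => rombergT f a b 0 k) atTop (𝓝 I)) (m : ℕ) :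
    Tendsto (fun k => rombergT f a b m k) atTop (𝓝 I) := by
  induction m with
  | zero => exact h0
  | succ m ih =>
    have h4 := four_pow_succ_sub_one_ne_zero m
    have hshift : Tendsto (fun k => rombergT f a b m (k + 1)) atTop (𝓝 I) :=
      ih.comp (tendsto_add_atTop_nat 1)
    have := ((hshift.const_mul ((4 : ℝ) ^ (m + 1))).sub ih).div_const ((4 : ℝ) ^ (m + 1) - 1)
    have hI : ((4 : ℝ) ^ (m + 1) * I - I) / (4 ^ (m + 1) - 1) = I := by
      field_simp
    rw [hI] at this
    simpa [rombergT_succ] using this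

/-- Property (1), column half, for `f ∈ C²[a, b]`: every column of the T-table converges to `∫_a^b f`.
[cite: DavisRabinowitz1984, Sect. 6.3 (6.3.4)] -/
theorem tendsto_rombergT_of_c2 {f : ℝ → ℝ} {a b : ℝ} (h_f_c2 : ContDiffOn ℝ 2 f [[a, b]]) {ζ : ℝ}
    (fpp_bound : ∀ x, |iteratedDerivWithin 2 f [[a, b]] x| ≤ ζ) (m : ℕ) :
    Tendsto (fun k => rombergT f a b m k) atTop (𝓝 (∫ x in a..b, f x)) := by
  refine tendsto_rombergT_column ?_ m
  have hbound := abs_rombergT_zero_sub_integral_le h_f_c2 fpp_bound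
  have hζ : 0 ≤ ζ := (abs_nonneg _).trans (fpp_bound a)
  have hlim : Tendsto (fun k : ℕ => |b - a| ^ 3 * ζ / (12 * 4 ^ k)) atTop (𝓝 0) := by
    have h1 : Tendsto (fun k : ℕ => ((4 : ℝ) ^ k)⁻¹) atTop (𝓝 0) := by
      simpa [← inv_pow] using tendsto_pow_atTop_nhds_zero_of_lt_one (by norm_num : (0 : ℝ) ≤ 4⁻¹)
        (by norm_num : (4 : ℝ)⁻¹ < 1)
    have := h1.const_mul (|b - a| ^ 3 * ζ / 12)
    rw [mul_zero] at this
    refine this.congr fun k => ?_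
    field_simp
  rw [tendsto_iff_norm_sub_tendsto_zero]
  refine squeeze_zero (fun k => norm_nonneg _) (fun k => ?_) hlim
  rw [Real.norm_eq_abs]
  exact hbound k

end

end Literature.Analysis.Quadrature
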